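import Mathlib
import Summits.HodgeConjecture.FermatCycles.HodgeFermatTheoremLRowsB
import Summits.HodgeConjecture.FermatCycles.HodgeFermatTheoremUEq
import Summits.HodgeConjecture.FermatCycles.HodgeFermatBridge

/-!
# THEOREM Z3U (`tables/DPRIME-THEOREM.md` §4) — the pattern (Z3, U) at the prime 3, from THEOREM KR6 — part 1 (`HodgeFermat/TheoremZ3U.lean`; HF-G29)

Tree copy (part 1 of 2) of the module `HodgeFermat/TheoremZ3U.lean` of the sibling cell's standalone package
`run/shared/lean/pub/pub-hodgefermat/lean/HodgeFermat/` (465 lines, sha256 `218d15e3579ca1b3…`), source lines 53–288 (§0 `KR6′`, `Z3UShape`, `Z3U`; §§1–4 residues, `rsum_const`, the Z3 fibre count revisited, the core identity and `sameType_down`).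
Filed by cell `pub-hfermat`, seat prover-1 gen-3, on the COORDINATOR KEEPER RULING of 2026-08-25 (gem sweep H1: take the
off-gate kernel theorem `thmFstar` through the gate) — here THEOREM F* of `tables/DPRIME-THEOREM.md` §9 IN FULL, i.e.
PROPOSITION D′(3N) and the descent (`HodgeFermat/PropDPrimeNFinal.lean`, GATE HF-G34), the last off-gate form of THEOREM F*
(its first two forms, `DecodingFinal.thmFstar` = F* at the prime levels and `ThmFstarNFinal.thmFstar` = F*(3N), landed on
2026-08-25 as `HodgeFermatThmFstar.lean` / `HodgeFermatThmFstarN.lean`, seats prover-1 gen-0 / gen-2); this file is one link of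
the import closure of `PropDPrimeNFinal.propDprime` (the sibling's KR-free chain: THEOREM L, COROLLARY M, THEOREM D6,
THEOREM U⁺, THEOREM KR6, THEOREM Z3U) on top of those landed chains.  The source module is the sibling's hub-checked module of
record (pub-hodgefermat `CERT.md` l.933, GATE HF-G29); its declarations are copied VERBATIM.
Deviations from the source module, exhaustively: the `import` lines (tree modules `Summits.HodgeConjecture.FermatCycles.
HodgeFermat*` instead of `HodgeFermat.*`); this module docstring; DEDUP (pre-empting the gate's `dedup.landed`): the source's `lemma res_pos'` (l.94–95) restates `HodgeFermat.KRFree.Bridge.res_pos` of `HodgeFermatBridge.lean` and the source's `lemma unit_mul_not_dvd` (l.97–99) restates the landed `HodgeFermat.KRFree.Decoding.unit_mul_not_dvd` (`HodgeFermatDecodingC.lean`), VERBATIM up to names; both DELETED and re-bound by the added lines `open HodgeFermat.KRFree.Bridge renaming res_pos → res_pos'` / `open HodgeFermat.KRFree.Decoding (unit_mul_not_dvd)` (extra imports); the file ends at source l.288 with an `end` line (part 2 = `HodgeFermatTheoremZ3UB.lean`).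
Every other line — in particular every declaration's statement and proof — is byte-identical to the source.
HONEST FRAMING: explicit algebraic cycles for specific Hodge classes on Fermat/Delsarte varieties; residual open instances
listed; no claim on general Hodge.  (This file is arithmetic of CM types / finite combinatorics / analytic number theory
of the sibling's KR-free programme; it claims nothing about cycles.)

The source module's docstring (TheoremZ3U.lean l.7–51), verbatim:

## THEOREM Z3U (`tables/DPRIME-THEOREM.md` §4) — the pattern (Z3, U) at the prime 3, from THEOREM KR6 (HF-G29)

THEOREM L (`TheoremLRows.lean`, generation 21) settles the row (Z3, U) of the local sieve for every prime `p ≥ 5`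
(`row_Z3U`: a triple divisible by `p` and a triple of units at `p` never have the same CM type at level `pn`).  At
`p = 3` the row is NOT empty: `3·(1, 2, 4) ∼ (1, 4, 16)` at level `21` (a disjoint pair in the size-6 class of F21a).  THEOREM
Z3U of `tables/DPRIME-THEOREM.md` §4 says this is all there is:

* `Z3UShape` / `z3uShape_of_kr6 : KR6' → Z3UShape` — **at a squarefree level `m = 3n` (`n` odd), a Z3-at-3 triple
  `T = (3a, 3b, 3c)` (no entry `≡ 0 (mod m)`) and an all-unit-at-3 triple `T' = (x, y, z)` of level `m` with the same
  CM type satisfy `7 ∣ n` and `n/7` divides all six of `a, b, c, x, y, z`** — the pair is `(n/7)` times a pair of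
  level `21`;
* `Z3U` / `z3u_of_kr6 : KR6' → Z3U` — **if moreover the pair is jointly primitive (no prime of `m` divides all six
  entries; disjoint or not), then `m = 21`** — THEOREM Z3U verbatim.

The hypothesis `KR6'` is the VERBATIM copy of `TheoremKR.KR6` (THEOREM KR6, generation 28: at a squarefree level
prime to `6` two triples with the same CM type are permutations of each other mod the level); this LIGHT module
imports `TheoremLRows` (LEMMA N, the Z3 fibre count) and `TheoremUEq` (`Perm3`) only, and `TheoremZ3UFinal.lean`
discharges the hypothesis definitionally (`kr6' := TheoremKR.kr6`).  With it, the two sentences of the hand proof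
of THEOREM Z3U that quoted Koblitz–Rohrlich (`W_{T₀}` and "`H_{T̄′} = H_{T₀} ⟹ T̄′ = T₀`" at the level `n = m/3`
prime to `6`; COROLLARY D6′ (ii) of `tables/KR-FREE.md` §7 since generation 18) are kernel theorems, and so is Z3U.

PROOF (DPRIME §4, made explicit).  Write `R(t) = ⟨tx⟩_n + ⟨ty⟩_n + ⟨tz⟩_n ∈ {0, n, 2n}` for the residue sum of
`T̄′ = T′ mod n` and `h(t) = [t ∈ H_{T₀}]`, `T₀ = (a, b, c)` at level `n`.
(1) FIBRE COMPARISON (`core_raw`).  For a unit `t₀` of `ℤ/n` and `3t₁ ≡ t₀`: the fibre count of `T` over `t̄₀` is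
    `2·h(t₀)` (`fibreCount_Z3_eq`: the two unit lifts of `t̄₀` have residues `3⟨t₀a⟩_n, 3⟨t₀b⟩_n`), that of `T′` is
    given by LEMMA N (U) at `p = 3`: `2n·N + 2R(t₀) + n = 3n + 2R(t₁)`; equal CM types give
    `h(t₀) ⟹ R(t₁) = R(t₀) + n` and `¬h(t₀) ⟹ R(t₀) = R(t₁) + n`.
(2) NO ENTRY OF `T′` IS `≡ 0 (mod n)` (`no_zero`): otherwise `R` is constant on units (`rsum_const`), contradicting (1)
    at `t₀ = 1`.  Hence `R ∈ {n, 2n}` on units, `t ∈ H_{T̄′} ⟺ R(t) = n`, and (1) reads (`core`):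
    `H_{T₀} = H_{T̄′}` on `(ℤ/n)ˣ` AND `3̄⁻¹t ∈ H_{T̄′} ⟺ t ∉ H_{T̄′}`.
(3) With the negation symmetry `R(−t) + R(t) = 3n` (`rsum_neg'`): `−3̄⁻¹ t ∈ H_{T̄′} ⟺ t ∈ H_{T̄′}`, i.e. the unit
    `w = −3̄` (realised as `3(n − 1)`) satisfies `H_{wT̄′} = H_{T̄′}` (`stab`).
(4) THEOREM KR6 at the level `n` (squarefree, prime to 6) applied to `T̄′` and `wT̄′`: `wT̄′` is a permutation of `T̄′`
    mod `n`.  A fixed entry `x ≡ wx` is impossible (`no_fix`: `(1 − w)x ≡ 4x ≡ 0`, `n` odd, `x ≢ 0`); so the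
    permutation is a 3-cycle, `y ≡ wz, z ≡ wx` (or its inverse), and `0 ≡ x + y + z ≡ (1 + w + w²)x ≡ 7x`
    (`cycle_seven`); likewise `7y ≡ 7z ≡ 0 (mod n)`.  As `x ≢ 0`, `7 ∣ n`, and `n/7 ∣ x, y, z` (`seven_dvd`).
(5) THEOREM KR6 at level `n` applied to `T₀` and `T̄′` (same CM type by (2)): `T₀` is a permutation of `T̄′` mod `n`,
    so `n/7 ∣ a, b, c` too (`z3uShape_of_kr6`).  Joint primitivity at level `m` leaves `n/7 = 1` (`z3u_of_kr6`).
No computation enters (the two uses of THEOREM KR6 carry generation 28's inputs); no `sorry`, no `native_decide`;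
axioms of every theorem = the three.  Hub record `check/Z3U_standalone.lean` (bodies `LemmaN`, `LemmaO`, `TheoremLRows`,
`TheoremUEq`, this file; `--axioms HodgeFermat.KRFree.TheoremZ3U.z3u_of_kr6`), link check `check/Z3ULink_standalone.lean`
(`TheoremKR.kr6` POSTULATED with a citation of its records, then `TheoremZ3UFinal.lean` verbatim: `--axioms …z3u` = the
three + exactly `HodgeFermat.KRFree.TheoremKR.kr6`).  `GATE.md` § HF-G29; `tables/DPRIME-THEOREM.md` §4; paper §1 (xiv).
-/

set_option autoImplicit false

namespace HodgeFermat.KRFree.TheoremZ3U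

open Finset HodgeFermat.KRFree.LemmaN HodgeFermat.KRFree.LemmaO HodgeFermat.KRFree.TheoremL
open HodgeFermat.KRFree.TheoremUEq (Perm3 rsum_rot)

open HodgeFermat.KRFree.Bridge renaming res_pos → res_pos'
open HodgeFermat.KRFree.Decoding (unit_mul_not_dvd)

/-! ## Statements -/

/-- VERBATIM copy of `HodgeFermat.KRFree.TheoremKR.KR6` (THEOREM KR6, generation 28): at a squarefree level `N`
prime to `6`, two triples of level `N` (zero sum, no entry `≡ 0 (mod N)`) with the same CM type are permutations of
each other as residues mod `N`.  `TheoremZ3UFinal.kr6' : KR6' := TheoremKR.kr6`. -/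
def KR6' : Prop :=
  ∀ N a b c a' b' c' : ℕ, Squarefree N → ¬ 2 ∣ N → ¬ 3 ∣ N →
    N ∣ a + b + c → N ∣ a' + b' + c' →
    ¬ N ∣ a → ¬ N ∣ b → ¬ N ∣ c → ¬ N ∣ a' → ¬ N ∣ b' → ¬ N ∣ c' →
    SameType N (a, b, c) (a', b', c') → Perm3 (a % N) (b % N) (c % N) (a' % N) (b' % N) (c' % N)

/-- **THEOREM Z3U, shape form** (no primitivity assumed): at a squarefree level `3n`, `n` odd, a Z3-at-3 triple
`(3a, 3b, 3c)` with no entry `≡ 0 (mod 3n)` and a triple `(x, y, z)` of units at `3`, both of level `3n`, with the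
same CM type, satisfy: `7 ∣ n` and `n / 7` divides `a, b, c, x, y, z`. -/
def Z3UShape : Prop :=
  ∀ n a b c x y z : ℕ, Squarefree (3 * n) → ¬ 2 ∣ n →
    3 * n ∣ 3 * a + 3 * b + 3 * c → 3 * n ∣ x + y + z →
    ¬ 3 * n ∣ 3 * a → ¬ 3 * n ∣ 3 * b → ¬ 3 * n ∣ 3 * c → ¬ 3 ∣ x → ¬ 3 ∣ y → ¬ 3 ∣ z →
    SameType (3 * n) (3 * a, 3 * b, 3 * c) (x, y, z) →
    7 ∣ n ∧ n / 7 ∣ a ∧ n / 7 ∣ b ∧ n / 7 ∣ c ∧ n / 7 ∣ x ∧ n / 7 ∣ y ∧ n / 7 ∣ z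

/-- **THEOREM Z3U** (`tables/DPRIME-THEOREM.md` §4): let `m = 3n` be squarefree (and odd), `(T, T′)` a JOINTLY
PRIMITIVE pair of triples of level `m` with the same CM type (disjoint or not), `T = 3T₀ = (3a, 3b, 3c)` with no
entry `≡ 0 (mod m)` and `T′ = (x, y, z)` all units at `3`.  Then `m = 21`. -/
def Z3U : Prop :=
  ∀ n a b c x y z : ℕ, Squarefree (3 * n) → ¬ 2 ∣ n →
    3 * n ∣ 3 * a + 3 * b + 3 * c → 3 * n ∣ x + y + z →
    ¬ 3 * n ∣ 3 * a → ¬ 3 * n ∣ 3 * b → ¬ 3 * n ∣ 3 * c → ¬ 3 ∣ x → ¬ 3 ∣ y → ¬ 3 ∣ z →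
    (∀ q, Nat.Prime q → q ∣ 3 * n →
      q ∣ 3 * a → q ∣ 3 * b → q ∣ 3 * c → q ∣ x → q ∣ y → q ∣ z → False) →
    SameType (3 * n) (3 * a, 3 * b, 3 * c) (x, y, z) → 3 * n = 21

/-! ## Residue helpers -/


/-- `3n` squarefree forces `n ≥ 1` -/
lemma pos_of_sq3 {n : ℕ} (hsq : Squarefree (3 * n)) : 0 < n := by
  refine Nat.pos_of_ne_zero ?_
  rintro rfl
  have h0 : Squarefree (0 : ℕ) := by rw [Nat.mul_zero] at hsq; exact hsq
  exact not_squarefree_zero h0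

/-- a prime factor `q` of a squarefree number does not divide the cofactor (as `TheoremD6.not_dvd_cofactor`) -/
lemma not_dvd_cofactor' {q n : ℕ} (hq : q.Prime) (hsq : Squarefree (q * n)) : ¬ q ∣ n := by
  rintro ⟨m, rfl⟩
  have h : q * q ∣ q * (q * m) := ⟨m, by ring⟩
  have hu := hsq q h
  rw [Nat.isUnit_iff] at hu
  exact hq.one_lt.ne' hu

/-- negation on residues: `⟨(−t)x⟩_n + ⟨tx⟩_n = n` when `n ∤ tx`, `−t` realised as `(n−1)t` (as `PropL7c.res_neg`) -/
lemma res_neg' {n x t : ℕ} (hn : 0 < n) (h : ¬ n ∣ t * x) : (n - 1) * t * x % n + t * x % n = n := by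
  obtain ⟨m, rfl⟩ : ∃ m, n = m + 1 := ⟨n - 1, by omega⟩
  rw [Nat.add_sub_cancel]
  have hsum : (m + 1) ∣ m * t * x % (m + 1) + t * x % (m + 1) := by
    apply Nat.dvd_of_mod_eq_zero
    rw [← Nat.add_mod, show m * t * x + t * x = t * x * (m + 1) by ring]
    exact Nat.mod_eq_zero_of_dvd (dvd_mul_left _ _)
  have b1 := Nat.mod_lt (m * t * x) hn
  have b2 := Nat.mod_lt (t * x) hn
  have hne : t * x % (m + 1) ≠ 0 := fun e => h (Nat.dvd_of_mod_eq_zero e)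
  obtain ⟨c, hc⟩ := hsum
  rcases Nat.lt_or_ge c 2 with hc2 | hc2
  · interval_cases c <;> omega
  · have : (m + 1) * 2 ≤ (m + 1) * c := Nat.mul_le_mul_left _ hc2
    omega

/-- the negation symmetry of the carry: `R(−t) + R(t) = 3n` for a triple with no zero residue (as `PropL7c.rsum_neg`) -/
lemma rsum_neg' {n a b c t : ℕ} (hn : 0 < n) (ha : ¬ n ∣ t * a) (hb : ¬ n ∣ t * b) (hc : ¬ n ∣ t * c) :
    rsum n (a, b, c) ((n - 1) * t) + rsum n (a, b, c) t = 3 * n := by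
  have h1 := res_neg' hn ha
  have h2 := res_neg' hn hb
  have h3 := res_neg' hn hc
  unfold rsum; dsimp only
  omega

/-- `−t = (n−1)t` is a unit when `t` is (as `PropL7c.coprime_neg`) -/
lemma coprime_neg' {n t : ℕ} (hn : 0 < n) (ht : Nat.Coprime t n) : Nat.Coprime ((n - 1) * t) n :=
  Nat.Coprime.mul_left ((Nat.coprime_self_sub_left hn).mpr (Nat.coprime_one_left n)) ht

/-- if the THIRD entry of a zero-sum triple is `≡ 0 (mod n)`, its residue sum is the same at all units
(as `PropL7a.rsum_const_of_dvd`) -/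
lemma rsum_const₃ {n x y z u t : ℕ} (hn : 0 < n) (hs : n ∣ x + y + z) (hz : n ∣ z)
    (hu : Nat.Coprime u n) (ht : Nat.Coprime t n) : rsum n (x, y, z) u = rsum n (x, y, z) t := by
  have hxy : n ∣ x + y := (Nat.dvd_add_left hz).mp hs
  unfold rsum; dsimp only
  rw [Nat.mod_eq_zero_of_dvd (dvd_mul_of_dvd_right hz u), Nat.mod_eq_zero_of_dvd (dvd_mul_of_dvd_right hz t)]
  by_cases hx : n ∣ x
  · have hy : n ∣ y := (Nat.dvd_add_right hx).mp hxy
    rw [Nat.mod_eq_zero_of_dvd (dvd_mul_of_dvd_right hx u), Nat.mod_eq_zero_of_dvd (dvd_mul_of_dvd_right hx t),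
      Nat.mod_eq_zero_of_dvd (dvd_mul_of_dvd_right hy u), Nat.mod_eq_zero_of_dvd (dvd_mul_of_dvd_right hy t)]
  · have hy : ¬ n ∣ y := fun hy => hx ((Nat.dvd_add_left hy).mp hxy)
    have two : ∀ w, Nat.Coprime w n → w * x % n + w * y % n = n := by
      intro w hw
      have h1 : 0 < w * x % n := res_pos' (unit_mul_not_dvd hw hx)
      have h2 : 0 < w * y % n := res_pos' (unit_mul_not_dvd hw hy)
      have h3 : (w * x % n + w * y % n) % n = 0 := by
        rw [← Nat.add_mod, ← mul_add]
        exact Nat.mod_eq_zero_of_dvd (dvd_mul_of_dvd_right hxy w)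
      have b1 := Nat.mod_lt (w * x) hn
      have b2 := Nat.mod_lt (w * y) hn
      obtain ⟨c, hc⟩ := Nat.dvd_of_mod_eq_zero h3
      rcases Nat.lt_or_ge c 2 with hc2 | hc2
      · interval_cases c <;> omega
      · have : n * 2 ≤ n * c := Nat.mul_le_mul_left n hc2
        omega
    rw [two u hu, two t ht]

/-- if SOME entry of a zero-sum triple is `≡ 0 (mod n)`, its residue sum is the same at all units -/
lemma rsum_const {n x y z u t : ℕ} (hn : 0 < n) (hs : n ∣ x + y + z) (h0 : n ∣ x ∨ n ∣ y ∨ n ∣ z)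
    (hu : Nat.Coprime u n) (ht : Nat.Coprime t n) : rsum n (x, y, z) u = rsum n (x, y, z) t := by
  rcases h0 with h | h | h
  · rw [← rsum_rot n x y z u, ← rsum_rot n x y z t]
    exact rsum_const₃ hn (by rwa [show y + z + x = x + y + z by ring]) h hu ht
  · rw [← rsum_rot n x y z u, ← rsum_rot n x y z t, ← rsum_rot n y z x u, ← rsum_rot n y z x t]
    exact rsum_const₃ hn (by rwa [show z + x + y = x + y + z by ring]) h hu ht
  · exact rsum_const₃ hn hs h hu ht

/-! ## LEMMA N (Z3), sharp form: the fibre count of `pT₀` over `t̄₀` is `(p − 1)·[t̄₀ ∈ H_{T₀}]` -/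

/-- for `T = (pa, pb, pc)` the residues of all lifts of `t̄₀` are `p⟨t₀a⟩_n, p⟨t₀b⟩_n`: the `p − 1` unit lifts all lie
in `H_T` if `t̄₀ ∈ H_{T₀}` at level `n` (`T₀ = (a, b, c)`), and none does otherwise -/
lemma fibreCount_Z3_eq (p n a b c t₀ : ℕ) (hp : p.Prime) (hpn : ¬ p ∣ n) (ht₀ : Nat.Coprime t₀ n) :
    fibreCount p n (p * a, p * b, p * c) t₀ = if InH n (a, b, c) t₀ then p - 1 else 0 := by
  obtain ⟨j₀, hj₀, hdiv⟩ := nonunit_exists p n t₀ hp hpn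
  have hconst : ∀ j, (InH (p * n) (p * a, p * b, p * c) (t₀ + j * n) ↔ InH n (a, b, c) t₀) := by
    intro j
    show (t₀ + j * n) * (p * a) % (p * n) + (t₀ + j * n) * (p * b) % (p * n) < p * n ↔
      t₀ * a % n + t₀ * b % n < n
    rw [first_mod, first_mod, ← mul_add]
    exact ⟨Nat.lt_of_mul_lt_mul_left, fun h => Nat.mul_lt_mul_of_pos_left h hp.pos⟩
  have hunit : ∀ j, j < p → (Nat.Coprime (t₀ + j * n) (p * n) ↔ j ≠ j₀) := by
    intro j hj
    constructor
    · intro hco hjj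
      subst hjj
      have h1 : Nat.Coprime p (p * n) := Nat.Coprime.coprime_dvd_left hdiv hco
      unfold Nat.Coprime at h1
      rw [Nat.gcd_mul_right_right] at h1
      exact hp.one_lt.ne' h1
    · intro hne
      apply lift_coprime hp ht₀
      intro hd
      exact hne (nonunit_unique hp hpn hj hj₀ hd hdiv)
  by_cases hI : InH n (a, b, c) t₀
  · rw [if_pos hI]
    unfold fibreCount
    have he : (range p).filter (fun j => Nat.Coprime (t₀ + j * n) (p * n)
        ∧ InH (p * n) (p * a, p * b, p * c) (t₀ + j * n)) = (range p).erase j₀ := by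
      ext j
      simp only [Finset.mem_filter, Finset.mem_range, Finset.mem_erase]
      constructor
      · rintro ⟨hj, hco, _⟩
        exact ⟨(hunit j hj).mp hco, hj⟩
      · rintro ⟨hne, hj⟩
        exact ⟨hj, (hunit j hj).mpr hne, (hconst j).mpr hI⟩
    rw [he, Finset.card_erase_of_mem (Finset.mem_range.mpr hj₀), Finset.card_range]
  · rw [if_neg hI]
    unfold fibreCount
    apply Finset.card_eq_zero.mpr
    apply Finset.filter_eq_empty_iff.mpr
    intro j _ h
    exact hI ((hconst j).mp h.2)

/-! ## (1) The fibre comparison at `p = 3` -/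

/-- the fibre counts of `T = 3T₀` and `T′` over a unit `t̄₀` of `ℤ/n` compared (LEMMA N (Z3) sharp form + LEMMA N (U)
at `p = 3`, `3t₁ ≡ t₀`): `t̄₀ ∈ H_{T₀} ⟹ R(t₁) = R(t₀) + n`, `t̄₀ ∉ H_{T₀} ⟹ R(t₀) = R(t₁) + n` -/
lemma core_raw {n a b c x y z t₀ t₁ : ℕ} (h3n : ¬ 3 ∣ n) (hn : 0 < n) (hs' : 3 * n ∣ x + y + z)
    (hx : ¬ 3 ∣ x) (hy : ¬ 3 ∣ y) (hz : ¬ 3 ∣ z) (hH : SameType (3 * n) (3 * a, 3 * b, 3 * c) (x, y, z))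
    (ht₀ : Nat.Coprime t₀ n) (ht₁ : 3 * t₁ ≡ t₀ [MOD n]) :
    (InH n (a, b, c) t₀ ∧ rsum n (x, y, z) t₁ = rsum n (x, y, z) t₀ + n) ∨
    (¬ InH n (a, b, c) t₀ ∧ rsum n (x, y, z) t₀ = rsum n (x, y, z) t₁ + n) := by
  have hN := lemmaN_U 3 n x y z t₀ t₁ Nat.prime_three h3n hn hs' hx hy hz ht₀ ht₁
  have hF := fibreCount_Z3_eq 3 n a b c t₀ Nat.prime_three h3n ht₀
  rw [fibreCount_congr hH] at hF
  rw [hF] at hN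
  by_cases hI : InH n (a, b, c) t₀
  · rw [if_pos hI] at hN
    left
    exact ⟨hI, by omega⟩
  · rw [if_neg hI] at hN
    right
    exact ⟨hI, by omega⟩

/-! ## (2) No entry of `T′` vanishes mod `n`; the comparison in final form -/

/-- no entry of `T′` is `≡ 0 (mod n)`: otherwise `R` is constant on the units, against `core_raw` at `t₀ = 1` -/
lemma no_zero {n a b c x y z : ℕ} (h3n : ¬ 3 ∣ n) (hn : 0 < n) (hs' : 3 * n ∣ x + y + z)
    (hx : ¬ 3 ∣ x) (hy : ¬ 3 ∣ y) (hz : ¬ 3 ∣ z) (hH : SameType (3 * n) (3 * a, 3 * b, 3 * c) (x, y, z)) :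
    ¬ n ∣ x ∧ ¬ n ∣ y ∧ ¬ n ∣ z := by
  have key : ¬ (n ∣ x ∨ n ∣ y ∨ n ∣ z) := by
    intro h0
    obtain ⟨t₁, ht₁⟩ := exists_t₁ 3 n 1 Nat.prime_three h3n hn
    have h1u : Nat.Coprime 1 n := Nat.coprime_one_left n
    have hc := rsum_const hn (dvd_of_level hs') h0 (coprime_t₁ ht₁ h1u) h1u
    rcases core_raw h3n hn hs' hx hy hz hH h1u ht₁ with ⟨-, e⟩ | ⟨-, e⟩ <;> omega
  exact ⟨fun h => key (Or.inl h), fun h => key (Or.inr (Or.inl h)), fun h => key (Or.inr (Or.inr h))⟩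

/-- THE COMPARISON: for a unit `t₀` of `ℤ/n` and `3t₁ ≡ t₀ (mod n)` — `t̄₀ ∈ H_{T₀} ⟺ t̄₀ ∈ H_{T̄′}` (equal CM types
at level `n`) and `t̄₁ ∈ H_{T̄′} ⟺ t̄₀ ∉ H_{T̄′}` (the `3̄⁻¹`-twist) -/
lemma core {n a b c x y z t₀ t₁ : ℕ} (h3n : ¬ 3 ∣ n) (hn : 0 < n) (hs' : 3 * n ∣ x + y + z)
    (hx : ¬ 3 ∣ x) (hy : ¬ 3 ∣ y) (hz : ¬ 3 ∣ z) (hH : SameType (3 * n) (3 * a, 3 * b, 3 * c) (x, y, z))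
    (ht₀ : Nat.Coprime t₀ n) (ht₁ : 3 * t₁ ≡ t₀ [MOD n]) :
    (InH n (a, b, c) t₀ ↔ InH n (x, y, z) t₀) ∧ (InH n (x, y, z) t₁ ↔ ¬ InH n (x, y, z) t₀) := by
  have hzn := (no_zero h3n hn hs' hx hy hz hH).2.2
  have hs1 : n ∣ x + y + z := dvd_of_level hs'
  have ht₁u : Nat.Coprime t₁ n := coprime_t₁ ht₁ ht₀
  obtain ⟨hR₀, hI₀⟩ := rsum_cases hn hs1 (unit_mul_not_dvd ht₀ hzn)
  obtain ⟨hR₁, hI₁⟩ := rsum_cases hn hs1 (unit_mul_not_dvd ht₁u hzn)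
  rw [hI₀, hI₁]
  rcases core_raw h3n hn hs' hx hy hz hH ht₀ ht₁ with ⟨hI, e⟩ | ⟨hI, e⟩
  · exact ⟨iff_of_true hI (by omega), iff_of_false (by omega) (by omega)⟩
  · exact ⟨iff_of_false hI (by omega), iff_of_true (by omega) (by omega)⟩

/-- equal CM types one level down: `H_{T₀} = H_{T̄′}` on `(ℤ/n)ˣ` -/
lemma sameType_down {n a b c x y z : ℕ} (h3n : ¬ 3 ∣ n) (hn : 0 < n) (hs' : 3 * n ∣ x + y + z)
    (hx : ¬ 3 ∣ x) (hy : ¬ 3 ∣ y) (hz : ¬ 3 ∣ z) (hH : SameType (3 * n) (3 * a, 3 * b, 3 * c) (x, y, z)) :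
    SameType n (a, b, c) (x, y, z) := by
  intro t ht
  obtain ⟨t₁, ht₁⟩ := exists_t₁ 3 n t Nat.prime_three h3n hn
  exact (core h3n hn hs' hx hy hz hH ht ht₁).1


end HodgeFermat.KRFree.TheoremZ3U
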